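import Literature.NumberTheory.Sieve.FordMaynardFragmentation
import Literature.NumberTheory.Sieve.FordMaynardFragmentationSymm
import HarnessLib

/-!
# Ford–Maynard, Theorem 6.4: preparations for the one-block fragmentation identity (Tzero)

Everything here is PROVED. Third file towards Theorem 6.4 of K. Ford, J. Maynard,
*On the theory of prime producing sieves* (arXiv:2407.14368). The identity (Tzero) of §6.1,
`T(y) = ∑_k (1/k!) ∫_{Δ_k} (𝓛_∞(u) − 𝓛_{1−γ}(u)) f(y,u)/(u₁⋯u_k) du = 0`, is deduced from
(TypeI-f) in the next file; here are the algebraic and bookkeeping ingredients: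

* set-function algebra: `sub_sconv`, `sconv_sub`, the **telescoping formula**
  `A^{⋆j} − B^{⋆j} = ∑_{i<j} (B^{⋆i} ⋆ A^{⋆(j−1−i)}) ⋆ (A − B)` (`spow_sub_spow`), vanishing of
  convolutions below their degree (`sconv_eq_zero_of_card_lt_add`), `sconv_empty`;
* the two blocks of `[a + b]`: `{i < a} = castAdd [a]`, its complement `= natAdd [b]`
  (`filter_lt_eq_map_castAddEmb`, `sdiff_filter_lt_eq_map_natAddEmb`), and naturality of the
  `N_{·,c}`-convolutions along these embeddings and under permutations
  (`sconv_spow_smallFn_castAdd`, `smallFn_natAdd`, `sconv_spow_smallFn_comp_perm`);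
* evaluation of `N_{u,c}([k])` on a slice (`smallFn_univ_eq_one`; the vanishing case `∑ u ≥ c` is
  `smallFn_eq_zero` of `SetFunctionConvolution` verbatim);
* **(TypeI-f) partial sums**: for `f ∈ 𝔉*_η(γ)` the partial sums `∑_{d ≤ M}` of (TypeI-f) at
  `ξ ∈ ℝ^r` already vanish for `M + r ≥ ⌊1/η⌋` (`MemTypeIStar.sum_typeITerm_eq_zero`);
* the re-indexing `∑_{k ≤ K} ∑_{1 ≤ a ≤ k} X(k,a) = ∑_{a ≤ K} ∑_{b ≤ K−a} X(a+b,a)`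
  (`sum_Icc_sum_Icc_eq`).

## References

* K. Ford, J. Maynard, *On the theory of prime producing sieves*, arXiv:2407.14368 (2024), §6.1
  (proof of Theorem 6.4, (Tzero)). [FordMaynard2024PrimeSieves]
-/

noncomputable section

open MeasureTheory Finset Literature.Combinatorics.Enumerative

namespace Literature.NumberTheory.Sieve.FordMaynard

/-! ### Set-function algebra -/

section SetFn

variable {α : Type*} [DecidableEq α]

/-- `(F − G) ⋆ H = F ⋆ H − G ⋆ H`, pointwise. [folklore] -/
theorem sub_sconv (F G H : Finset α → ℝ) (S : Finset α) :
    sconv (fun A => F A - G A) H S = sconv F H S - sconv G H S := by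
  simp [sconv, sub_mul, Finset.sum_sub_distrib]

/-- `F ⋆ (G − H) = F ⋆ G − F ⋆ H`, pointwise. [folklore] -/
theorem sconv_sub (F G H : Finset α → ℝ) (S : Finset α) :
    sconv F (fun A => G A - H A) S = sconv F G S - sconv F H S := by
  simp [sconv, mul_sub, Finset.sum_sub_distrib]

/-- `F ⋆ (∑_i G_i) = ∑_i F ⋆ G_i`, pointwise. [folklore] -/
theorem sconv_finset_sum {ι : Type*} (s : Finset ι) (F : Finset α → ℝ) (G : ι → Finset α → ℝ)
    (S : Finset α) : sconv F (fun A => ∑ i ∈ s, G i A) S = ∑ i ∈ s, sconv F (G i) S := by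
  rw [sconv_sum]

/-- **Telescoping**: `A^{⋆j} − B^{⋆j} = ∑_{i<j} (B^{⋆i} ⋆ A^{⋆(j−1−i)}) ⋆ (A − B)` (the
commutative convolution algebra of set functions). [folklore] -/
theorem spow_sub_spow (A B : Finset α → ℝ) :
    ∀ (j : ℕ) (S : Finset α), spow A j S - spow B j S =
      ∑ i ∈ Finset.range j, sconv (sconv (spow B i) (spow A (j - 1 - i))) (fun T => A T - B T) S
  | 0, S => by simp
  | j + 1, S => by
    have hIH : (fun T => spow A j T - spow B j T) = fun T =>
        ∑ i ∈ Finset.range j, sconv (sconv (spow B i) (spow A (j - 1 - i))) (fun T => A T - B T) T :=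
      funext (spow_sub_spow A B j)
    have h1 : spow A (j + 1) S - spow B (j + 1) S =
        sconv (fun T => A T - B T) (spow A j) S + sconv B (fun T => spow A j T - spow B j T) S := by
      rw [spow_succ, spow_succ, sub_sconv, sconv_sub]
      ring
    rw [h1, hIH, sconv_finset_sum, Finset.sum_range_succ', add_comm]
    congr 1
    · refine Finset.sum_congr rfl fun i _ => ?_
      have : j + 1 - 1 - (i + 1) = j - 1 - i := by omega
      rw [this, spow_succ, sconv_assoc, sconv_assoc, sconv_assoc]
    · simp only [spow_zero, sdelta_sconv, Nat.add_sub_cancel, Nat.sub_zero]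
      rw [sconv_comm]

/-- A convolution of set functions vanishing below cardinalities `a`, `b` vanishes below `a + b`.
[folklore] -/
theorem sconv_eq_zero_of_card_lt_add {F G : Finset α → ℝ} {a b : ℕ}
    (hF : ∀ T : Finset α, T.card < a → F T = 0) (hG : ∀ T : Finset α, T.card < b → G T = 0)
    {S : Finset α} (hS : S.card < a + b) : sconv F G S = 0 := by
  unfold sconv
  refine Finset.sum_eq_zero fun T hT => ?_
  rw [Finset.mem_powerset] at hT
  by_cases h : T.card < a
  · rw [hF T h, zero_mul]
  · rw [hG (S \ T) ?_, mul_zero]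
    have := Finset.card_sdiff_add_card_eq_card hT
    omega

/-- `(F ⋆ G)(∅) = F(∅) G(∅)`. [folklore] -/
theorem sconv_empty (F G : Finset α → ℝ) : sconv F G ∅ = F ∅ * G ∅ := by
  simp [sconv]

/-- `F^{⋆n}(∅) = [n = 0]` when `F(∅) = 0`. [folklore] -/
theorem spow_empty {F : Finset α → ℝ} (h0 : F ∅ = 0) (n : ℕ) :
    spow F n ∅ = if n = 0 then 1 else 0 := by
  cases n with
  | zero => simp [sdelta]
  | succ n => rw [spow_succ_empty h0]; simp

end SetFn

/-! ### The two blocks of `[a + b]` and naturality of the `N`-convolutions -/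

/-- `{i ∈ [a+b] : i < a}` is the image of `castAdd`. [folklore] -/
theorem filter_lt_eq_map_castAddEmb (a b : ℕ) :
    (Finset.univ.filter fun i : Fin (a + b) => (i : ℕ) < a) = Finset.univ.map (Fin.castAddEmb b) := by
  ext x
  simp only [Finset.mem_filter, Finset.mem_univ, true_and, Finset.mem_map]
  constructor
  · intro hx
    exact ⟨⟨x, hx⟩, Fin.ext rfl⟩
  · rintro ⟨y, rfl⟩
    exact y.2

/-- `{i ∈ [a+b] : i ≥ a}` is the image of `natAdd`. [folklore] -/
theorem sdiff_filter_lt_eq_map_natAddEmb (a b : ℕ) :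
    (Finset.univ \ Finset.univ.filter fun i : Fin (a + b) => (i : ℕ) < a) =
      Finset.univ.map (Fin.natAddEmb a) := by
  ext x
  simp only [Finset.mem_sdiff, Finset.mem_univ, Finset.mem_filter, true_and, not_lt,
    Finset.mem_map, Fin.natAddEmb_apply]
  constructor
  · intro hx
    refine ⟨⟨x - a, by omega⟩, Fin.ext ?_⟩
    simp only [Fin.val_natAdd]
    omega
  · rintro ⟨y, rfl⟩
    simp

/-- Naturality of `N^{⋆n}` along `castAdd`: evaluating on subsets of the first block only sees
the first block. [folklore] -/
theorem spow_smallFn_castAdd {a b : ℕ} (c : ℝ) (u : Fin (a + b) → ℝ) (n : ℕ) (S : Finset (Fin a)) :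
    spow (smallFn c u) n (S.map (Fin.castAddEmb b)) =
      spow (smallFn c (fun i => u (Fin.castAdd b i))) n S :=
  (spow_smallFn_map (Fin.castAddEmb b) c u n S).symm

/-- Naturality of `N^{⋆n}` along `natAdd`. [folklore] -/
theorem spow_smallFn_natAdd {a b : ℕ} (c : ℝ) (u : Fin (a + b) → ℝ) (n : ℕ) (S : Finset (Fin b)) :
    spow (smallFn c u) n (S.map (Fin.natAddEmb a)) =
      spow (smallFn c (fun i => u (Fin.natAdd a i))) n S :=
  (spow_smallFn_map (Fin.natAddEmb a) c u n S).symm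

/-- Naturality of `N` along `natAdd`. [folklore] -/
theorem smallFn_natAdd {a b : ℕ} (c : ℝ) (u : Fin (a + b) → ℝ) (S : Finset (Fin b)) :
    smallFn c u (S.map (Fin.natAddEmb a)) = smallFn c (fun i => u (Fin.natAdd a i)) S :=
  (smallFn_map (Fin.natAddEmb a) c u S).symm

/-- Naturality of the products `N_{c₁}^{⋆i} ⋆ N_{c₂}^{⋆i'}` along `castAdd`. [folklore] -/
theorem sconv_spow_smallFn_castAdd {a b : ℕ} (c₁ c₂ : ℝ) (i i' : ℕ) (u : Fin (a + b) → ℝ)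
    (S : Finset (Fin a)) :
    sconv (spow (smallFn c₁ u) i) (spow (smallFn c₂ u) i') (S.map (Fin.castAddEmb b)) =
      sconv (spow (smallFn c₁ (fun l => u (Fin.castAdd b l))) i)
        (spow (smallFn c₂ (fun l => u (Fin.castAdd b l))) i') S := by
  rw [← sconv_comp_map (Fin.castAddEmb b)]
  congr 1
  · funext B; exact spow_smallFn_castAdd c₁ u i B
  · funext B; exact spow_smallFn_castAdd c₂ u i' B

/-- Equivariance of the products `N_{c₁}^{⋆i} ⋆ N_{c₂}^{⋆i'}` under permutations. [folklore] -/
theorem sconv_spow_smallFn_comp_perm {k : ℕ} (c₁ c₂ : ℝ) (i i' : ℕ) (σ : Equiv.Perm (Fin k))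
    (u : Fin k → ℝ) (S : Finset (Fin k)) :
    sconv (spow (smallFn c₁ (u ∘ σ)) i) (spow (smallFn c₂ (u ∘ σ)) i') S =
      sconv (spow (smallFn c₁ u) i) (spow (smallFn c₂ u) i') (S.map σ.toEmbedding) := by
  rw [← sconv_comp_map σ.toEmbedding]
  congr 1
  · funext B; exact spow_smallFn_map σ.toEmbedding c₁ u i B
  · funext B; exact spow_smallFn_map σ.toEmbedding c₂ u i' B

/-- Equivariance of `N_{c₁} − N_{c₂}` under permutations. [folklore] -/
theorem smallFn_sub_comp_perm {k : ℕ} (c₁ c₂ : ℝ) (σ : Equiv.Perm (Fin k)) (u : Fin k → ℝ)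
    (S : Finset (Fin k)) :
    smallFn c₁ (u ∘ σ) S - smallFn c₂ (u ∘ σ) S =
      smallFn c₁ u (S.map σ.toEmbedding) - smallFn c₂ u (S.map σ.toEmbedding) := by
  rw [smallFn_comp_perm, smallFn_comp_perm]

/-- On a vector with `[k] ≠ ∅` and `∑ u < c`: `N_{u,c}([k]) = 1`. [folklore] -/
theorem smallFn_univ_eq_one {k : ℕ} (hk : 1 ≤ k) {c : ℝ} {u : Fin k → ℝ} (h : ∑ i, u i < c) :
    smallFn c u Finset.univ = 1 :=
  smallFn_eq_one (Finset.univ_nonempty_iff.2 ⟨⟨0, hk⟩⟩) h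

/-- The products `N_{c₁}^{⋆i} ⋆ N_{c₂}^{⋆i'}` vanish on sets of fewer than `i + i'` elements.
[folklore] -/
theorem sconv_spow_smallFn_eq_zero_of_card_lt {k : ℕ} (c₁ c₂ : ℝ) (i i' : ℕ) (u : Fin k → ℝ)
    {S : Finset (Fin k)} (hS : S.card < i + i') :
    sconv (spow (smallFn c₁ u) i) (spow (smallFn c₂ u) i') S = 0 :=
  sconv_eq_zero_of_card_lt_add (fun _ hT => spow_eq_zero_of_card_lt (smallFn_empty c₁ u) hT)
    (fun _ hT => spow_eq_zero_of_card_lt (smallFn_empty c₂ u) hT) hS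

/-- `(N_{c₁}^{⋆i} ⋆ N_{c₂}^{⋆i'})(∅) = [i = 0][i' = 0]`. [folklore] -/
theorem sconv_spow_smallFn_empty {k : ℕ} (c₁ c₂ : ℝ) (i i' : ℕ) (u : Fin k → ℝ) :
    sconv (spow (smallFn c₁ u) i) (spow (smallFn c₂ u) i') ∅ =
      (if i = 0 then 1 else 0) * (if i' = 0 then 1 else 0) := by
  rw [sconv_empty, spow_empty (smallFn_empty c₁ u), spow_empty (smallFn_empty c₂ u)]

/-! ### (TypeI-f): the partial sums already vanish from `⌊1/η⌋ − r` on -/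

/-- For `f ∈ 𝔉*_η(γ)` (`η > 0`) and `ξ ∈ ℝ^r` with `|ξ| ≤ γ`, the partial sums of (TypeI-f)
vanish as soon as they contain all the (finitely many) non-zero terms:
`∑_{d=1}^{M} (1/d!) ∫_{Δ_d(1−|ξ|)} f(ξ,u)/∏u = 0` for `M + r ≥ ⌊1/η⌋` (the terms with
`r + d > 1/η` vanish, `f` being supported in dimension `≤ 1/η`).
[cite: FordMaynard2024PrimeSieves, Definition 6.2 (c) and the remark after Definition 6.2] -/
theorem MemTypeIStar.sum_typeITerm_eq_zero {η γ : ℝ} {f : VecFn} (hf : MemTypeIStar η γ f)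
    (hη : 0 < η) {r : ℕ} (ξ : Fin r → ℝ) (hξ : ∑ i, ξ i ≤ γ) {M : ℕ} (hM : maxBlock η ≤ M + r) :
    ∑ d ∈ Finset.Icc 1 M, typeITerm f r ξ d = 0 := by
  obtain ⟨N₀, hN₀⟩ := hf.typeI r ξ hξ
  have hvan : ∀ d, M < d → typeITerm f r ξ d = 0 := by
    intro d hd
    unfold typeITerm
    have hdim : 1 / η < (r + d : ℕ) := by
      have h1 : (1 / η : ℝ) < maxBlock η + 1 := Nat.lt_floor_add_one (1 / η)
      have h2 : (maxBlock η : ℝ) + 1 ≤ (r + d : ℕ) := by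
        have : maxBlock η + 1 ≤ r + d := by omega
        exact_mod_cast this
      linarith
    have : (fun u : Fin d → ℝ => f (r + d) (Fin.append ξ u) / ∏ i, u i) = fun _ => 0 := by
      funext u
      rw [hf.eq_zero_of_lt hη hdim, zero_div]
    rw [this, sliceIntegral_zero, mul_zero]
  rw [← hN₀ (max M N₀) (le_max_right _ _)]
  refine Finset.sum_subset (Finset.Icc_subset_Icc_right (le_max_left _ _)) fun d hd hdM => hvan d ?_
  simp only [Finset.mem_Icc, not_and, not_le] at hd hdM
  exact hdM hd.1

/-! ### Re-indexing a triangular double sum -/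

/-- `∑_{k=1}^{K} ∑_{a=1}^{k} X(k,a) = ∑_{a=1}^{K} ∑_{b=0}^{K−a} X(a+b,a)`. [folklore] -/
theorem sum_Icc_sum_Icc_eq (K : ℕ) (X : ℕ → ℕ → ℝ) :
    ∑ k ∈ Finset.Icc 1 K, ∑ a ∈ Finset.Icc 1 k, X k a =
      ∑ a ∈ Finset.Icc 1 K, ∑ b ∈ Finset.range (K - a + 1), X (a + b) a := by
  rw [Finset.sum_sigma', Finset.sum_sigma']
  refine Finset.sum_nbij' (fun p => ⟨p.2, p.1 - p.2⟩) (fun q => ⟨q.1 + q.2, q.1⟩) ?_ ?_ ?_ ?_ ?_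
  · rintro ⟨k, a⟩ h
    simp only [Finset.mem_sigma, Finset.mem_Icc, Finset.mem_range] at h ⊢
    omega
  · rintro ⟨a, b⟩ h
    simp only [Finset.mem_sigma, Finset.mem_Icc, Finset.mem_range] at h ⊢
    omega
  · rintro ⟨k, a⟩ h
    simp only [Finset.mem_sigma, Finset.mem_Icc] at h
    simp only [Nat.add_sub_cancel' h.2.2]
  · rintro ⟨a, b⟩ _
    simp only [Nat.add_sub_cancel_left]
  · rintro ⟨k, a⟩ h
    simp only [Finset.mem_sigma, Finset.mem_Icc] at h
    show X k a = X (a + (k - a)) a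
    rw [Nat.add_sub_cancel' h.2.2]

/-- `∑_{a=0}^{k} X(a) = X(0) + ∑_{a=1}^{k} X(a)`. [folklore] -/
theorem sum_range_succ_eq_add_sum_Icc (k : ℕ) (X : ℕ → ℝ) :
    ∑ a ∈ Finset.range (k + 1), X a = X 0 + ∑ a ∈ Finset.Icc 1 k, X a := by
  rw [Finset.sum_range_succ', add_comm, show Finset.Icc 1 k = Finset.Ico 1 (k + 1) from rfl,
    Finset.sum_Ico_eq_sum_range]
  simp only [Nat.add_sub_cancel, add_comm 1]

end Literature.NumberTheory.Sieve.FordMaynard
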